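import Summits.Ventures.CertifiedArithmetic.LowPrec.SRTreeLimitedBits
import HarnessLib

/-!
# Limited-randomness SR on ARBITRARY summation trees, II: the bias-shifted exponential envelope
# (venture file LXXI of the SR slice)

HONEST FRAMING: certified error envelopes and provably optimal rounding/accumulation schemes for
low-precision formats under stated cost models; every table by two implementations; no hardware or
vendor claims.

Continuation of `SRTreeLimitedBits` (the model `treeExpQ F q T`: every node of the summation tree `T`
rounds with a perturbed rule `q`, `|q η − η| ≤ ε`, `q([0,1]) ⊆ [0,1]`), over `ℝ`:

* `treeExpQ_exp_le` — **mgf, any order**: under `NoSatT ∧ GapLET G`,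
  `E[e^{t(ŝ_T − ∑ leaves)}] ≤ e^{m (t²G²/8 + |t| ε G)}`, `m = T.nodes` (Hoeffding's lemma about the
  perturbed conditional mean at every node, inner subtree first, plus the drift `|t| ε G`);
* `treeQ_prob_dev_ge_le_exp` — **shifted tail**: `P(|ŝ_T − ∑ leaves| ≥ t + m ε G) ≤ 2 e^{−2t²/(m G²)}`,
  and the λ-form `treeQ_prob_dev_ge_lambda_le`: the exact-SR `√m` envelope of `SRTreeHoeffding`
  (recovered at `ε = 0`) around the worst-case drift `m ε G`;
* `stochasticA/B/C_tree_prob_dev_ge_le_exp` — the three IEEE P3109 rules with `N` random bits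
  (`ε = 2^{-N}`, `2^{-(N+1)}`, `2^{-(N+1)}`); on the left comb these are the recursive-summation
  statements of `SRHoeffdingLimitedBits` (`treeExpQ_comb`).

Placement as in `SRTreeLimitedBits`: the finite-format absolute-error counterpart, for every tree, of
the martingale-plus-bias structure of El Arar–Fasi–Filip–Mikaitis (arXiv:2603.24161, 2026) Thm. 2
(pairwise summation under `SR_{p,r}`, relative model).  No claim beyond that.
-/

namespace Summit.Ventures.CertifiedArithmetic.LowPrec.SR.LimitedBits

open Literature.ComputerArithmetic.P3109
open Literature.ComputerArithmetic.ConnollyHighamMary2021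
open Summit.Ventures.CertifiedArithmetic.LowPrec.SR
open Finset Real STree

/-! ### The moment generating function along the tree (over `ℝ`) -/

/-- One node, shifted: if `c` is in the hull and its candidate gap is `≤ G`, then for every `e`,
`E[e^{t(result − e)}] ≤ e^{t(c − e)} · e^{t²G²/8 + |t| ε G}`. -/
theorem stepQ_exp_shift_le (F : Finset ℝ) {q : ℝ → ℝ} {ε : ℝ}
    (hq01 : ∀ η, 0 ≤ η → η ≤ 1 → 0 ≤ q η ∧ q η ≤ 1) (hq : ∀ η, 0 ≤ η → η ≤ 1 → |q η - η| ≤ ε)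
    {c : ℝ} (hc : InHull F c) (t e : ℝ) {G : ℝ}
    (hg : roundUp F (clamp F c) - roundDown F (clamp F c) ≤ G) :
    stepQ F q c (fun v => exp (t * (v - e)))
      ≤ exp (t * (c - e)) * exp (t ^ 2 * G ^ 2 / 8 + |t| * (ε * G)) := by
  have hcl : clamp F c = c := clamp_eq_self hc
  have hf : (fun v => exp (t * (v - e)))
      = fun v => exp (t * (c - e)) * exp (t * (v - clamp F c)) := by
    funext v; rw [← exp_add, hcl]; ring_nf
  rw [hf, stepQ_mul_left]
  exact mul_le_mul_of_nonneg_left (stepQ_exp_le F hq01 hq c t hg) (exp_pos _).le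

/-- **The tree mgf bound, perturbed rule.** Under `NoSatT ∧ GapLET G`, for every real `t`,
`E[e^{t(ŝ_T − ∑ leaves)}] ≤ e^{m (t²G²/8 + |t| ε G)}`, `m = T.nodes`. -/
theorem treeExpQ_exp_le (F : Finset ℝ) {q : ℝ → ℝ} {ε : ℝ}
    (hq01 : ∀ η, 0 ≤ η → η ≤ 1 → 0 ≤ q η ∧ q η ≤ 1) (hq : ∀ η, 0 ≤ η → η ≤ 1 → |q η - η| ≤ ε)
    (G t : ℝ) : ∀ T : STree ℝ, NoSatT F T → GapLET F G T →
    treeExpQ F q T (fun v => exp (t * (v - T.exact)))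
      ≤ exp (T.nodes * (t ^ 2 * G ^ 2 / 8 + |t| * (ε * G)))
  | .leaf x, _, _ => by simp [treeExpQ, STree.exact, STree.nodes]
  | .node l r, ⟨hl, hr, hh⟩, ⟨hgl, hgr, hg⟩ => by
      simp only [treeExpQ, STree.exact, STree.nodes]
      have ihl := treeExpQ_exp_le F hq01 hq G t l hl hgl
      have ihr := treeExpQ_exp_le F hq01 hq G t r hr hgr
      set B1 := exp (t ^ 2 * G ^ 2 / 8 + |t| * (ε * G)) with hB1
      set Br := exp ((r.nodes : ℝ) * (t ^ 2 * G ^ 2 / 8 + |t| * (ε * G))) with hBr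
      set Bl := exp ((l.nodes : ℝ) * (t ^ 2 * G ^ 2 / 8 + |t| * (ε * G))) with hBl
      -- (1) the perturbed Hoeffding step at the root, for every pair of subtree outcomes `(a, b)`
      have hA : treeExpQ F q l (fun a => treeExpQ F q r (fun b =>
            stepQ F q (a + b) (fun v => exp (t * (v - (l.exact + r.exact))))))
          ≤ treeExpQ F q l (fun a => treeExpQ F q r (fun b =>
            exp (t * (a - l.exact)) * (B1 * exp (t * (b - r.exact))))) := by
        refine treeExpQ_mono_of_allOut F hq01 l (allOut_mono F l (fun a ha => ?_)
          (allOut_and F l hh hg))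
        refine treeExpQ_mono_of_allOut F hq01 r
          (allOut_mono F r (fun b hb => ?_) (allOut_and F r ha.1 ha.2))
        refine (stepQ_exp_shift_le F hq01 hq hb.1 t _ hb.2).trans (le_of_eq ?_)
        rw [show t * (a + b - (l.exact + r.exact)) = t * (a - l.exact) + t * (b - r.exact) by ring,
          exp_add]
        ring
      -- (2) the right subtree's mgf, for every value `a` of the left subtree
      have hB : ∀ a, treeExpQ F q r (fun b => exp (t * (a - l.exact)) * (B1 * exp (t * (b - r.exact))))
          ≤ (B1 * Br) * exp (t * (a - l.exact)) := by
        intro a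
        rw [treeExpQ_mul_left, treeExpQ_mul_left]
        have h0 : 0 ≤ exp (t * (a - l.exact)) := (exp_pos _).le
        have h1 : 0 ≤ B1 := (exp_pos _).le
        calc exp (t * (a - l.exact)) * (B1 * treeExpQ F q r (fun b => exp (t * (b - r.exact))))
            ≤ exp (t * (a - l.exact)) * (B1 * Br) := by gcongr
          _ = (B1 * Br) * exp (t * (a - l.exact)) := by ring
      -- (3) the left subtree's mgf
      calc treeExpQ F q l (fun a => treeExpQ F q r (fun b =>
              stepQ F q (a + b) (fun v => exp (t * (v - (l.exact + r.exact))))))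
          ≤ treeExpQ F q l (fun a => treeExpQ F q r (fun b =>
              exp (t * (a - l.exact)) * (B1 * exp (t * (b - r.exact))))) := hA
        _ ≤ treeExpQ F q l (fun a => (B1 * Br) * exp (t * (a - l.exact))) :=
            treeExpQ_mono F hq01 l hB
        _ = (B1 * Br) * treeExpQ F q l (fun a => exp (t * (a - l.exact))) :=
            treeExpQ_mul_left F q l _ _
        _ ≤ (B1 * Br) * Bl := mul_le_mul_of_nonneg_left ihl (by positivity)
        _ = exp (((l.nodes + r.nodes + 1 : ℕ) : ℝ) * (t ^ 2 * G ^ 2 / 8 + |t| * (ε * G))) := by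
            rw [hB1, hBr, hBl, ← exp_add, ← exp_add]; push_cast; ring_nf

/-! ### The bias-shifted exponential tail, any order (over `ℝ`) -/

/-- **Shifted exponential envelope for limited-randomness SR summation in ANY order.** If
`q : [0,1] → [0,1]` with `|q η − η| ≤ ε`, no node saturates and every candidate gap is `≤ G`
(`0 ≤ G`), then for every `t > 0`, `P(|ŝ_T − ∑ leaves| ≥ t + m ε G) ≤ 2 exp(−2t²/(m G²))`,
`m = T.nodes` (for `m G² = 0` the right-hand side is `2`). -/
theorem treeQ_prob_dev_ge_le_exp (F : Finset ℝ) {q : ℝ → ℝ} {ε : ℝ}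
    (hq01 : ∀ η, 0 ≤ η → η ≤ 1 → 0 ≤ q η ∧ q η ≤ 1) (hq : ∀ η, 0 ≤ η → η ≤ 1 → |q η - η| ≤ ε)
    {G : ℝ} (hG : 0 ≤ G) (T : STree ℝ) (h : NoSatT F T) (hg : GapLET F G T) (t : ℝ) (ht : 0 < t) :
    treeExpQ F q T (devInd (t + T.nodes * (ε * G)) T.exact)
      ≤ 2 * exp (-2 * t ^ 2 / (T.nodes * G ^ 2)) := by
  have hε : 0 ≤ ε := (abs_nonneg _).trans (hq 0 le_rfl zero_le_one)
  have hD0 : 0 ≤ (T.nodes : ℝ) * (ε * G) := by positivity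
  set m := T.exact with hm
  set S := t + T.nodes * (ε * G) with hS
  -- one-sided Chernoff bounds for θ ≥ 0
  have one_sided : ∀ {θ : ℝ}, 0 ≤ θ →
      treeExpQ F q T (upDevInd S m)
          ≤ exp (-(θ * S)) * exp (T.nodes * (θ ^ 2 * G ^ 2 / 8 + θ * (ε * G)))
      ∧ treeExpQ F q T (dnDevInd S m)
          ≤ exp (-(θ * S)) * exp (T.nodes * (θ ^ 2 * G ^ 2 / 8 + θ * (ε * G))) := by
    intro θ hθ
    have hab : |θ| = θ := abs_of_nonneg hθ
    have hab' : |-θ| = θ := by rw [abs_neg, hab]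
    constructor
    · calc treeExpQ F q T (upDevInd S m)
          ≤ treeExpQ F q T (fun v => exp (-(θ * S)) * exp (θ * (v - m))) :=
            treeExpQ_mono F hq01 T (fun v => upDevInd_le_exp S m v hθ)
        _ ≤ exp (-(θ * S)) * exp (T.nodes * (θ ^ 2 * G ^ 2 / 8 + θ * (ε * G))) := by
            rw [treeExpQ_mul_left]
            refine mul_le_mul_of_nonneg_left ?_ (exp_pos _).le
            have := treeExpQ_exp_le F hq01 hq G θ T h hg
            rwa [hab] at this
    · calc treeExpQ F q T (dnDevInd S m)
          ≤ treeExpQ F q T (fun v => exp (-(θ * S)) * exp (-θ * (v - m))) :=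
            treeExpQ_mono F hq01 T (fun v => dnDevInd_le_exp S m v hθ)
        _ ≤ exp (-(θ * S)) * exp (T.nodes * (θ ^ 2 * G ^ 2 / 8 + θ * (ε * G))) := by
            rw [treeExpQ_mul_left]
            refine mul_le_mul_of_nonneg_left ?_ (exp_pos _).le
            have := treeExpQ_exp_le F hq01 hq G (-θ) T h hg
            rwa [hab', neg_sq] at this
  have hsplit : treeExpQ F q T (devInd S m)
      ≤ treeExpQ F q T (upDevInd S m) + treeExpQ F q T (dnDevInd S m) := by
    rw [← treeExpQ_add]; exact treeExpQ_mono F hq01 T (fun v => devInd_le_up_add_dn S m v)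
  by_cases hD : (T.nodes : ℝ) * G ^ 2 = 0
  · have h1 := one_sided le_rfl
    simp only [zero_mul, neg_zero, exp_zero, one_mul, ne_eq, zero_pow, OfNat.ofNat_ne_zero,
      not_false_eq_true, zero_div, zero_add, mul_zero] at h1
    rw [hD, div_zero, exp_zero, mul_one]
    linarith [h1.1, h1.2]
  · have hpos : 0 < (T.nodes : ℝ) * G ^ 2 := lt_of_le_of_ne (by positivity) (Ne.symm hD)
    set θ := 4 * t / (T.nodes * G ^ 2) with hθ
    have hθ0 : 0 ≤ θ := by positivity
    have h1 := one_sided hθ0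
    -- θ S = θ t + θ m ε G: the drift term cancels exactly
    have key : exp (-(θ * S)) * exp (T.nodes * (θ ^ 2 * G ^ 2 / 8 + θ * (ε * G)))
        = exp (-2 * t ^ 2 / (T.nodes * G ^ 2)) := by
      rw [← exp_add]; congr 1
      rw [hS, hθ]; field_simp; ring
    rw [key] at h1
    linarith [h1.1, h1.2]

/-- The **λ-form, any order**: deviation at least `λ (G/2) √m + m ε G` has probability at most
`2 e^{−λ²/2}` (`0 < λ`, `0 < G`, `0 < m`). -/
theorem treeQ_prob_dev_ge_lambda_le (F : Finset ℝ) {q : ℝ → ℝ} {ε : ℝ}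
    (hq01 : ∀ η, 0 ≤ η → η ≤ 1 → 0 ≤ q η ∧ q η ≤ 1) (hq : ∀ η, 0 ≤ η → η ≤ 1 → |q η - η| ≤ ε)
    {G : ℝ} (hG : 0 < G) (T : STree ℝ) (hm : 0 < T.nodes) (h : NoSatT F T) (hg : GapLET F G T)
    {lam : ℝ} (hlam : 0 < lam) :
    treeExpQ F q T (devInd (lam * (G / 2) * Real.sqrt T.nodes + T.nodes * (ε * G)) T.exact)
      ≤ 2 * exp (-lam ^ 2 / 2) := by
  have hn' : (0 : ℝ) < T.nodes := by exact_mod_cast hm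
  have ht : 0 < lam * (G / 2) * Real.sqrt T.nodes := by positivity
  refine (treeQ_prob_dev_ge_le_exp F hq01 hq hG.le T h hg _ ht).trans (le_of_eq ?_)
  have hs : Real.sqrt (T.nodes : ℝ) ^ 2 = T.nodes := Real.sq_sqrt hn'.le
  have : -2 * (lam * (G / 2) * Real.sqrt T.nodes) ^ 2 / (T.nodes * G ^ 2) = -lam ^ 2 / 2 := by
    rw [mul_pow, mul_pow, hs]; field_simp
  rw [this]

/-! ### The three P3109 rules, any order -/

/-- **StochasticA (`N` bits), any order**: `P(|ŝ_T − ∑| ≥ t + m G 2^{-N}) ≤ 2 exp(−2t²/(m G²))`. -/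
theorem stochasticA_tree_prob_dev_ge_le_exp (F : Finset ℝ) (N : ℕ) {G : ℝ} (hG : 0 ≤ G)
    (T : STree ℝ) (h : NoSatT F T) (hg : GapLET F G T) (t : ℝ) (ht : 0 < t) :
    treeExpQ F (probAwayA N) T (devInd (t + T.nodes * (1 / 2 ^ N * G)) T.exact)
      ≤ 2 * exp (-2 * t ^ 2 / (T.nodes * G ^ 2)) :=
  treeQ_prob_dev_ge_le_exp F (probAwayA_mem N) (fun η _ _ => abs_probAwayA_sub_le N η) hG T h hg t ht

/-- **StochasticB (`N` bits), any order**: `P(|ŝ_T − ∑| ≥ t + m G 2^{-(N+1)}) ≤ 2 exp(−2t²/(m G²))`. -/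
theorem stochasticB_tree_prob_dev_ge_le_exp (F : Finset ℝ) (N : ℕ) {G : ℝ} (hG : 0 ≤ G)
    (T : STree ℝ) (h : NoSatT F T) (hg : GapLET F G T) (t : ℝ) (ht : 0 < t) :
    treeExpQ F (probAwayB N) T (devInd (t + T.nodes * (1 / 2 ^ (N + 1) * G)) T.exact)
      ≤ 2 * exp (-2 * t ^ 2 / (T.nodes * G ^ 2)) :=
  treeQ_prob_dev_ge_le_exp F (probAwayB_mem N) (fun η _ _ => abs_probAwayB_sub_le N η) hG T h hg t ht

/-- **StochasticC (`N` bits), any order**: `P(|ŝ_T − ∑| ≥ t + m G 2^{-(N+1)}) ≤ 2 exp(−2t²/(m G²))`. -/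
theorem stochasticC_tree_prob_dev_ge_le_exp (F : Finset ℝ) (N : ℕ) {G : ℝ} (hG : 0 ≤ G)
    (T : STree ℝ) (h : NoSatT F T) (hg : GapLET F G T) (t : ℝ) (ht : 0 < t) :
    treeExpQ F (probAwayC N) T (devInd (t + T.nodes * (1 / 2 ^ (N + 1) * G)) T.exact)
      ≤ 2 * exp (-2 * t ^ 2 / (T.nodes * G ^ 2)) :=
  treeQ_prob_dev_ge_le_exp F (probAwayC_mem N) (fun η _ _ => abs_probAwayC_sub_le N η) hG T h hg t ht

end Summit.Ventures.CertifiedArithmetic.LowPrec.SR.LimitedBits
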